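import Literature.NumberTheory.EllipticCurves.KatoTwistedFinitenessQuadraticTwistProofs
import Literature.NumberTheory.EllipticCurves.RootNumberTwistProofs
import Literature.NumberTheory.EllipticCurves.Pal2012.QuadraticTwistPeriod
import Literature.NumberTheory.EllipticCurves.Delbourgo1998.RankZeroLeadingTerm
import Literature.NumberTheory.EllipticCurves.KodairaNeronLeFourProofs
import Literature.NumberTheory.EllipticCurves.TamagawaSubgroupProofs
import Literature.NumberTheory.EllipticCurves.BSDConductorProofs
import Literature.NumberTheory.EllipticCurves.PAdicLFunctionNeZeroHoldsProofs
import Literature.NumberTheory.EllipticCurves.QuadraticTwistJInvariantProofs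
import Summits.BirchSwinnertonDyer.Rank1Residual.Additive.UnramifiedBaseChange
import Summits.BirchSwinnertonDyer.Rank1Residual.Additive.ChiBranchInput
import HarnessLib

/-!
# The additive twist at `p ≡ 1 (mod 4)`: `L(E,1) = ±ϖ·(∑ (a/p)[a/p]⁺_{f♭})·Ω_E`, `c_p(E) ≤ 4`, `∏c = c_p·∏_{ℓ≠p}c` (cell `b2b-bsdres`, seat additive-p4, line V9, links [E][F][G])

HONEST FRAMING (cell `b2b-bsdres`, run/shared/lean/b2b/bsd-rank1-residual/, verbatim in every
file): the goal of the cell is to DELETE the COMBINATION-SHAPED residual classes of the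
Birch–Swinnerton-Dyer formula for ALL analytic-rank `≤ 1` elliptic curves over `ℚ` — "full BSD
formula for every rank `≤ 1` curve in class `C`" assembled STRICTLY from published theorems — so
that the rank-`≤ 1` remainder becomes exactly the CONSTRUCTION-SHAPED classes, which are TYPED
(missing-input `Prop`s), NOT attempted. This is not "finishing BSD". The additive sub-cell (seats
additive-p1…p4) is a RESEARCH ROUTE on the construction-shaped classes X3/X4; no claim beyond the
stated classes; the label of X3 is UNCHANGED.

Theorems only (no definition, no new named fact). The ANALYTIC and BOOKKEEPING links of the research
line V9 (HOME/b2b-bsdres-additive-p4/V9-CHAIN.md) at `p ≡ 1 (mod 4)` for an elliptic curve `E = W/ℚ`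
additive at `p` which is `ℚ`-isomorphic to the quadratic twist by `p` (`= p*`) of a globally minimal
`V = E♭` good or multiplicative at `p`, `f = f♭` the newform of `V`, `ϖ·Ω_V = Ω⁺_f`:

* `intCast_LFunction_eq_jacobiChar_mul_cuspCoeff` — [F] `aₙ(E) = (n/p)·aₙ(f)` for all `n` (the
  tree's `LFunction_quadraticTwist_pStar_apply` for `p ∤ n`; `aₙ(E) = 0` for `p ∣ n` at an additive
  `p`, `LFunction_apply_eq_zero_of_hasAdditiveReductionAt`);
* `entireLFunction_one_eq_of_twist` — **`L(E, 1) = ε·ϖ·(∑_{a mod p} (a/p)[a/p]⁺_f)·Ω_E`, `ε = ±1`**: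
  Birch's formula `(∑ …)·Ω⁺_f = τ(χ_p)·L(E,1)` (tree theorem `ratTwistedSymbolSum_mul_plusPeriod_holds`,
  `χ_p = jacobiChar p` even, primitive), `τ(χ_p)² = p` (Mathlib `gaussSum_sq`), and [E] Pal 2012
  Thm. 3.2 with Prop. 2.5 (`Ω_V = √p·Ω_E`, named fact `hPal`, p202706), modularity `hmod`;
* `tamagawaProduct_eq_tamagawaNumberAt_mul_finprod` (`∏_ℓ c_ℓ = c_p·∏_{ℓ≠p} c_ℓ` in the shape of
  Delbourgo's fact), `tamagawaNumberAt_ne_zero_and_le_four_of_addv` (`1 ≤ c_p ≤ 4` at an additive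
  prime: Kodaira–Néron, tree theorem `index_goodReductionSubgroup_le_four_holds`),
  `padicValNat_tamagawaNumberAt_eq_zero_of_addv` (`p ∤ c_p` for `p ≥ 5`),
  `exists_variableChange_quadraticTwist_symm` (the twist relation read backwards).
Consumer: `Additive/X3RankZeroSemistableTwist.lean` (the assembly with Delbourgo 1998 Prop. 4).

References: Pal 2012 [Pal2012] Thm. 3.2, Prop. 2.5; Mazur–Tate–Teitelbaum 1986
[MazurTateTeitelbaum1986Invent] §I.8 (8.6) (Birch's formula); Silverman *AEC* X.2, Ex. 10.16
(twists), *ATAEC* IV.9.2 (Kodaira–Néron).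
-/

noncomputable section

open scoped Classical MatrixGroups ModularForm

open CongruenceSubgroup WeierstrassCurve Literature.NumberTheory.EllipticCurves
  Literature.NumberTheory.EllipticCurves.ModularForms
  Literature.NumberTheory.EllipticCurves.Rank1Residual

namespace Summit.BirchSwinnertonDyer.Rank1Residual.Additive

/-! ## §2 The analytic side at `p ≡ 1 (mod 4)`: `L(E, 1) = ± ϖ · (∑_{a mod p} (a/p)[a/p]⁺_{f♭}) · Ω_E` -/

section Analytic

open Literature.NumberTheory.QuadraticFields Rat.HeightOneSpectrum

variable (p : ℕ) [hp : Fact p.Prime]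

omit hp in
/-- `p ≡ 1 (mod 4)` ⇒ `(−1)^{⌊p/2⌋} = 1`, i.e. `p* = p`. -/
theorem neg_one_pow_half_eq_one_of_mod_four_eq_one (hp4 : p % 4 = 1) : (-1 : ℤ) ^ (p / 2) = 1 := by
  have h : Even (p / 2) := ⟨p / 4, by omega⟩
  exact h.neg_one_pow

/-- The Legendre character `χ_p = (·/p)` modulo an odd prime (tree `jacobiChar p`) is non-trivial,
quadratic and primitive. -/
theorem jacobiChar_prime_ne_one_isQuadratic_isPrimitive (hp2 : p ≠ 2) :
    haveI : NeZero p := ⟨hp.out.ne_zero⟩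
    jacobiChar p ≠ 1 ∧ (jacobiChar p).IsQuadratic ∧ (jacobiChar p).IsPrimitive := by
  have hodd : Odd p := hp.out.odd_of_ne_two hp2
  have hsq : Squarefree p := hp.out.prime.squarefree
  exact ⟨jacobiChar_ne_one hodd hsq hp.out.one_lt.ne', isQuadratic_jacobiChar,
    isPrimitive_jacobiChar hodd hsq⟩

/-- For `p ≡ 1 (mod 4)` the Legendre character is EVEN: `(−1/p) = 1`. -/
theorem jacobiChar_even_of_mod_four_eq_one (hp4 : p % 4 = 1) :
    haveI : NeZero p := ⟨hp.out.ne_zero⟩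
    (jacobiChar p).Even := by
  haveI : NeZero p := ⟨hp.out.ne_zero⟩
  have hodd : Odd p := hp.out.odd_of_ne_two ((by omega))
  show jacobiChar p (-1) = 1
  have h := jacobiChar_intCast (q := p) (-1)
  rw [Int.cast_neg, Int.cast_one] at h
  rw [h, jacobiSym.at_neg_one hodd, ZMod.χ₄_nat_one_mod_four hp4, Int.cast_one]

/-- The rational `∑ (a/p)[a/p]⁺_f`, cast to `ℂ`, is the tree's twisted symbol sum at the Legendre
character. -/
theorem cast_legendrePlusSymbolSum_eq_ratTwistedSymbolSum {N : ℕ} (f : CuspForm (Gamma0 N) 2) :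
    haveI : NeZero p := ⟨hp.out.ne_zero⟩
    ((legendrePlusSymbolSum f p : ℚ) : ℂ) = ratTwistedSymbolSum f (jacobiChar p) := by
  haveI : NeZero p := ⟨hp.out.ne_zero⟩
  rw [legendrePlusSymbolSum_def, ratTwistedSymbolSum]
  push_cast
  refine Finset.sum_congr rfl fun a _ ↦ ?_
  rw [jacobiChar_apply, ← jacobiSym.legendreSym.to_jacobiSym]

/-- **The twist `L`-identity [F], coefficientwise: `aₙ(E) = (n/p) · aₙ(f♭)`** for the additive
curve `E = W ≅ V ⊗ χ_p` (`p ≡ 1 (mod 4)`, so `p* = p`) and the newform `f = f♭` of `V`: for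
`p ∤ n` this is the tree's `LFunction_quadraticTwist_pStar_apply`, for `p ∣ n` both sides vanish
(`W` additive at `p`). -/
theorem intCast_LFunction_eq_jacobiChar_mul_cuspCoeff (hp4 : p % 4 = 1)
    (V W : WeierstrassCurve ℚ) [V.IsElliptic] [W.IsElliptic]
    (hVW : ∃ C : VariableChange ℚ, C • V.quadraticTwist (p : ℚ) = W) (hadd : Addv W p)
    {N : ℕ} [NeZero N] {f : CuspForm (Gamma0 N) 2} (hf : IsNewformOf V f) (n : ℕ) :
    haveI : NeZero p := ⟨hp.out.ne_zero⟩
    ((W.LFunction n : ℤ) : ℂ) = jacobiChar p n * cuspCoeff f n := by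
  haveI : NeZero p := ⟨hp.out.ne_zero⟩
  have hp2 : p ≠ 2 := (by omega)
  obtain ⟨C, hC⟩ := hVW
  rw [jacobiChar_natCast, ← jacobiSym.legendreSym.to_jacobiSym]
  by_cases hpn : p ∣ n
  · have hv := primesEquiv_symm_apply_coe p
    have h0 := W.LFunction_apply_eq_zero_of_hasAdditiveReductionAt hv
      (hasAdditiveReductionAt_of_addv W p hadd) hpn
    have hleg : legendreSym p (n : ℤ) = 0 :=
      (legendreSym.eq_zero_iff p (n : ℤ)).mpr (by exact_mod_cast (ZMod.natCast_eq_zero_iff n p).mpr hpn)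
    rw [h0, hleg]
    push_cast
    ring
  · have hpstar : (((-1 : ℤ) ^ (p / 2) * p : ℤ) : ℚ) = (p : ℚ) := by
      rw [neg_one_pow_half_eq_one_of_mod_four_eq_one p hp4]
      push_cast
      ring
    have key := V.LFunction_quadraticTwist_pStar_apply hp2 hpn
    rw [hpstar] at key
    haveI := V.isElliptic_quadraticTwist (d := (p : ℚ)) (by exact_mod_cast hp.out.ne_zero)
    rw [← hC, LFunction_smul, key, hf.2 n]
    push_cast
    ring

/-- **[E] + [F] + Birch at `p ≡ 1 (mod 4)`: `L(E, 1) = ε · ϖ · (∑_{a mod p} (a/p)[a/p]⁺_{f♭}) · Ω_E`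
with `ε = ±1`.** Here `E = W` is additive at `p`, `ℚ`-isomorphic to the twist by `p` of `V = E♭`
(good or multiplicative at `p`, newform `f`, `ϖ · Ω_V = Ω⁺_f`). Birch's formula (tree theorem
`ratTwistedSymbolSum_mul_plusPeriod_holds`) gives `(∑ (a/p)[a/p]⁺_f) · Ω⁺_f = τ(χ_p) · L(E,1)`
(the coefficients of `E` being those of `f ⊗ χ_p`), `τ(χ_p)² = p` (Mathlib `gaussSum_sq`), and Pal
2012 Thm. 3.2 (named fact `hPal`, p202706) gives `Ω⁺_f = ϖ Ω_V = ϖ √p Ω_E`; so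
`L(E,1) = (√p/τ(χ_p)) · ϖ · (∑ …) · Ω_E` with `√p/τ(χ_p) = ±1`. -/
theorem entireLFunction_one_eq_of_twist
    (hPal : Pal2012.thm32_sqrt_mul_realPeriodRat_twist_eq_of_prime_one_mod_four)
    (hmod : hasEntireLFunction_rat) (hp4 : p % 4 = 1)
    (V W : WeierstrassCurve ℚ) [V.IsElliptic] [V.IsGloballyMinimal] [W.IsElliptic]
    [W.IsGloballyMinimal] (hVW : ∃ C : VariableChange ℚ, C • V.quadraticTwist (p : ℚ) = W)
    (hV : Good V p ∨ Mult V p) (hadd : Addv W p)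
    {N : ℕ} [NeZero N] {f : CuspForm (Gamma0 N) 2} (hf : IsNewformOf V f)
    (ϖ : ℚ) (hϖ : (ϖ : ℝ) * V.realPeriodRat = plusPeriod f) :
    ∃ ε : ℚ, (ε = 1 ∨ ε = -1) ∧
      W.entireLFunction 1 =
        ((ε * (ϖ * legendrePlusSymbolSum f p) : ℚ) : ℂ) * (W.realPeriodRat : ℂ) := by
  haveI : NeZero p := ⟨hp.out.ne_zero⟩
  have hp2 : p ≠ 2 := (by omega)
  obtain ⟨hχ1, hχq, hχprim⟩ := jacobiChar_prime_ne_one_isQuadratic_isPrimitive p hp2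
  have hχe := jacobiChar_even_of_mod_four_eq_one p hp4
  set χ := jacobiChar p with hχdef
  have hE : W.HasEntireLFunction := hmod W
  -- [F]: the Dirichlet coefficients of `W` are those of `f ⊗ χ`
  have hco : ∀ n : ℕ, ((W.LFunction n : ℤ) : ℂ) = χ n * cuspCoeff f n :=
    fun n ↦ intCast_LFunction_eq_jacobiChar_mul_cuspCoeff p hp4 V W hVW hadd hf n
  have hL' : ∀ s : ℂ, 2 < s.re → W.entireLFunction s = twistedLSeries f χ⁻¹ s := by
    intro s hs
    rw [hχq.inv, W.entireLFunction_eq_LSeries hE (by linarith), LSeries_eq_twistedLSeries_of_coeff W f χ hco]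
  -- Birch's formula
  have hB := ratTwistedSymbolSum_mul_plusPeriod_holds hf.1 hf.coeffField_eq_bot hχprim hχe
    (W.differentiable_entireLFunction hE) hL'
  rw [← cast_legendrePlusSymbolSum_eq_ratTwistedSymbolSum p f] at hB
  -- `τ(χ)² = p`
  set τ : ℂ := gaussSum χ (ZMod.stdAddChar (N := p)) with hτdef
  have hτsq : τ ^ 2 = (p : ℂ) := by
    rw [hτdef, gaussSum_sq hχ1 hχq (ZMod.isPrimitive_stdAddChar p), hχe, one_mul, ZMod.card]
  -- [E]: Pal's period relation, and `ϖ Ω_V = Ω⁺_f`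
  have hPal' : Real.sqrt p * W.realPeriodRat = V.realPeriodRat := hPal V W p hp4 hV hVW
  have hper : (plusPeriod f : ℂ) = (ϖ : ℂ) * (Real.sqrt p : ℂ) * (W.realPeriodRat : ℂ) := by
    rw [← Complex.ofReal_ratCast, ← hϖ, ← hPal']
    push_cast
    ring
  have hsqrt : ((Real.sqrt p : ℝ) : ℂ) ^ 2 = (p : ℂ) := by
    rw [← Complex.ofReal_pow, Real.sq_sqrt (Nat.cast_nonneg p)]
    push_cast
    rfl
  have hsqrt0 : ((Real.sqrt p : ℝ) : ℂ) ≠ 0 := by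
    rw [Complex.ofReal_ne_zero]
    exact Real.sqrt_ne_zero'.mpr (by exact_mod_cast hp.out.pos)
  -- `τ = ± √p`
  have hτpm : τ = (Real.sqrt p : ℂ) ∨ τ = -(Real.sqrt p : ℂ) := by
    have h0 : (τ + (Real.sqrt p : ℂ)) * (τ - (Real.sqrt p : ℂ)) = 0 := by
      rw [← sq_sub_sq, hτsq, hsqrt, sub_self]
    rcases mul_eq_zero.mp h0 with h | h
    · exact Or.inr (eq_neg_of_add_eq_zero_left h)
    · exact Or.inl (sub_eq_zero.mp h)
  rw [hper] at hB
  -- `S · ϖ · √p · Ω_W = τ · L`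
  rcases hτpm with h | h
  · refine ⟨1, Or.inl rfl, ?_⟩
    rw [h] at hB
    have : W.entireLFunction 1 = (legendrePlusSymbolSum f p : ℂ) * (ϖ : ℂ) * (W.realPeriodRat : ℂ) := by
      apply mul_left_cancel₀ hsqrt0
      linear_combination -hB
    rw [this]
    push_cast
    ring
  · refine ⟨-1, Or.inr rfl, ?_⟩
    rw [h] at hB
    have : W.entireLFunction 1 = -((legendrePlusSymbolSum f p : ℂ) * (ϖ : ℂ) * (W.realPeriodRat : ℂ)) := by
      apply mul_left_cancel₀ hsqrt0
      linear_combination hB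
    rw [this]
    push_cast
    ring

end Analytic

/-! ## §3 Bookkeeping: the Tamagawa factor at `p`; the twist relation read backwards -/

section Bookkeeping

open IsDedekindDomain NumberField Rat.HeightOneSpectrum

variable (W : WeierstrassCurve ℚ) [W.IsElliptic] (p : ℕ) [hp : Fact p.Prime]

/-- `∏_ℓ c_ℓ(E) = c_p(E) · ∏_{ℓ ≠ p} c_ℓ(E)`, the second factor written as in Delbourgo's named fact
(`∏ᶠ_v (if p ∈ v then 1 else c_v)`). -/
theorem tamagawaProduct_eq_tamagawaNumberAt_mul_finprod :
    W.tamagawaProduct =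
      W.tamagawaNumberAt ((primesEquiv (R := 𝓞 ℚ)).symm ⟨p, hp.out⟩) *
        ∏ᶠ v : HeightOneSpectrum (𝓞 ℚ),
          (if (p : 𝓞 ℚ) ∈ v.asIdeal then 1 else W.tamagawaNumberAt v) := by
  classical
  set v₀ : HeightOneSpectrum (𝓞 ℚ) := (primesEquiv (R := 𝓞 ℚ)).symm ⟨p, hp.out⟩ with hv₀
  have hmem : ∀ v : HeightOneSpectrum (𝓞 ℚ), (p : 𝓞 ℚ) ∈ v.asIdeal ↔ v = v₀ :=
    fun v ↦ natCast_mem_asIdeal_iff_eq_primesEquiv_symm v hp.out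
  have hfin : (Function.mulSupport fun v : HeightOneSpectrum (𝓞 ℚ) ↦ W.tamagawaNumberAt v).Finite :=
    W.mulSupport_localTamagawaNumber_finite_holds
  set a : HeightOneSpectrum (𝓞 ℚ) → ℕ := fun v ↦ if v = v₀ then W.tamagawaNumberAt v else 1 with ha
  set b : HeightOneSpectrum (𝓞 ℚ) → ℕ := fun v ↦ if v = v₀ then 1 else W.tamagawaNumberAt v with hb
  have hab : (fun v : HeightOneSpectrum (𝓞 ℚ) ↦ W.tamagawaNumberAt v) = fun v ↦ a v * b v := by
    funext v
    by_cases h : v = v₀ <;> simp [ha, hb, h]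
  have hafin : (Function.mulSupport a).Finite := by
    refine (Set.finite_singleton v₀).subset fun v hv ↦ ?_
    rw [Set.mem_singleton_iff]
    by_contra h
    exact hv (by simp [ha, h])
  have hbfin : (Function.mulSupport b).Finite := by
    refine hfin.subset fun v hv ↦ ?_
    by_cases h : v = v₀
    · exact absurd (by simp [hb, h]) hv
    · simpa [hb, h] using hv
  rw [tamagawaProduct_eq_finprod_tamagawaNumberAt, hab, finprod_mul_distrib hafin hbfin,
    finprod_eq_single a v₀ (fun v hv ↦ if_neg hv)]
  congr 1
  · simp [ha]
  · exact finprod_congr fun v ↦ by by_cases h : v = v₀ <;> simp [hb, h, hmem]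

/-- **`c_p(E) ∈ {1, 2, 3, 4}` at an ADDITIVE prime** (Kodaira–Néron, Silverman *ATAEC* IV.9.2 (d);
tree theorem `index_goodReductionSubgroup_le_four_holds`): additive reduction is not split
multiplicative. -/
theorem tamagawaNumberAt_ne_zero_and_le_four_of_addv (hadd : Addv W p) :
    W.tamagawaNumberAt ((primesEquiv (R := 𝓞 ℚ)).symm ⟨p, hp.out⟩) ≠ 0 ∧
      W.tamagawaNumberAt ((primesEquiv (R := 𝓞 ℚ)).symm ⟨p, hp.out⟩) ≤ 4 := by
  set v₀ : HeightOneSpectrum (𝓞 ℚ) := (primesEquiv (R := 𝓞 ℚ)).symm ⟨p, hp.out⟩ with hv₀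
  have haddv : W.HasAdditiveReductionAt v₀ := hasAdditiveReductionAt_of_addv W p hadd
  haveI := W.isElliptic_localMinimalModel v₀
  have hns : ¬ (W.localMinimalModel v₀).HasSplitMultiplicativeReduction
      (v₀.adicCompletionIntegers ℚ) :=
    fun hs ↦ haddv.not_hasMultiplicativeReduction _ hs.toHasMultiplicativeReduction
  rw [tamagawaNumberAt_def, localTamagawaNumber_baseChange_eq]
  exact (W.localMinimalModel v₀).index_goodReductionSubgroup_le_four_holds _ hns

/-- At an additive prime `p ≥ 5`, `p ∤ c_p(E)` (since `c_p ≤ 4`). -/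
theorem padicValNat_tamagawaNumberAt_eq_zero_of_addv (hadd : Addv W p) (hp5 : 5 ≤ p) :
    padicValNat p (W.tamagawaNumberAt ((primesEquiv (R := 𝓞 ℚ)).symm ⟨p, hp.out⟩)) = 0 := by
  obtain ⟨h0, h4⟩ := tamagawaNumberAt_ne_zero_and_le_four_of_addv W p hadd
  refine padicValNat.eq_zero_of_not_dvd fun h ↦ h0 ?_
  exact Nat.eq_zero_of_dvd_of_lt h (by omega)

omit [W.IsElliptic] hp in
/-- Reading the twist relation backwards: if `W ≅ V^{(d)}` over `ℚ` then `V ≅ W^{(d)}` (`d ≠ 0`),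
since `(V^{(d)})^{(d)} = V^{(d²)} ≅ V`. -/
theorem exists_variableChange_quadraticTwist_symm (V : WeierstrassCurve ℚ) {d : ℚ} (hd : d ≠ 0)
    (hVW : ∃ C : VariableChange ℚ, C • V.quadraticTwist d = W) :
    ∃ C : VariableChange ℚ, C • W.quadraticTwist d = V := by
  haveI : NeZero (2 : ℚ) := ⟨two_ne_zero⟩
  obtain ⟨C, hC⟩ := hVW
  obtain ⟨C₁, hC₁⟩ := V.exists_variableChange_quadraticTwist_one
  obtain ⟨C₂, hC₂⟩ := V.exists_variableChange_quadraticTwist_mul_sq 1 d hd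
  have h1 : W.quadraticTwist d =
      (⟨C.u, d * C.r, 0, 0⟩ : VariableChange ℚ) • V.quadraticTwist (1 * d ^ 2) := by
    rw [← hC, quadraticTwist_smul, quadraticTwist_quadraticTwist, one_mul, pow_two]
  refine ⟨((⟨C.u, d * C.r, 0, 0⟩ : VariableChange ℚ) * (C₂ * C₁))⁻¹, ?_⟩
  rw [h1, ← hC₂, ← hC₁]
  simp only [smul_smul]
  rw [inv_mul_cancel, one_smul]

end Bookkeeping

end Summit.BirchSwinnertonDyer.Rank1Residual.Additive

end
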